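import Summits.BirchSwinnertonDyer.BirchSwinnertonDyer.Theorems.PrintCFramBottomClassIndexLawFiveLeHerbrandKummerLeopoldtLower
import Summits.BirchSwinnertonDyer.BirchSwinnertonDyer.Theorems.PrintCFramBottomClassIndexLawFiveLeHerbrandKummerReflectionCountEvenCharacters
import Mathlib.GroupTheory.FiniteAbelian.Basic
import HarnessLib

/-!
# Route `PrintCFram`, crux C2 `BottomClassIndexLawFiveLe` (stmt-BirchSwinnertonDyer-20372), line
# `eisenstein-resource-bdp-line` (B1 first-order census, CASE R): **A NON-CYCLIC ODD COMPONENT FORCES EVEN-IRREGULARITY** —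
# `e_χ(ℤ_p ⊗ Cl K)` not cyclic ⟹ two jointly onto `χ̄`-equivariant characters `Cl(K) → ℤ/p` ⟹ (Leopoldt, lower direction,
# `HerbrandKummer.prime_le_classGroupChiCard_of_two_equivariant_classGroupHoms`) `p ≤ #e_{ω χ̄⁻¹}(ℤ_p ⊗ Cl K)`
# (cell `bsd-print-cfram`, width seat `bsd-line-cfram-p1-w7` g4; helper `--supports` 20372; 0 defs, 0 facts, 0 sorry)

HONEST FRAMING. Nothing about BSD is proved here; no summit statement is proved by this seat; no stub is closed. This is the
component-currency front end of `…HerbrandKummerLeopoldtLower.lean` (this seat, p685291): the census sub-branch «`v_p(B_{1,χ⁻¹}) ≥ 2`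
with NON-CYCLIC `χ`-part» (LEAD g12 00:40:10Z, w2 g11 00:48:04Z «second item») is stated on the `χ`-component
`e_χ(ℤ_p ⊗ Cl K) = classGroupChiComponent ℚ K p (ω∘χ̄)` of `ClassGroupUnitsGaloisModules` (the currency of Mazur–Wiles Thm. 2), and
this file converts «not cyclic» into the two equivariant characters the Leopoldt count consumes.

* `exists_two_addMonoidHom_surjective_of_not_isAddCyclic` — a finite abelian group of `p`-power order which is not cyclic has two
  homomorphisms to `ℤ/p` that are jointly onto (structure theorem `AddCommGroup.equiv_directSum_zmod_of_finite'`: two cyclic factors,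
  each of order a positive power of `p`, and their reductions mod `p`);
* **`exists_two_equivariant_classGroupHoms_of_not_isAddCyclic`** — `K` a number field, `χ : Aut_ℚ(K) →* ℤ_pˣ` with integer
  shadow `n` (`‖χ σ − n σ‖ < 1`), `e_χ(ℤ_p ⊗ Cl(𝓞 K))` NOT cyclic ⟹ `∃ φ₁ φ₂ : Cl(𝓞 K) →* ℤ/p` (multiplicative copy) with
  `φᵢ(σ•c) = φᵢ(c)^{n σ}` and `(φ₁, φ₂)` onto. Mechanism: `Cl ↠ ℤ_p ⊗ Cl ↠ e_χ(ℤ_p ⊗ Cl)` (`toPadicTensor_surjective`, `rangeRestrict`)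
  is `Gal(K/ℚ)`-equivariant with `σ` acting on the component by the scalar `χ σ ≡ n σ (mod p)` (`charProjector_comm`,
  `apply_charProjector_character`), so ANY additive functional of the component pulled back to `Cl` is `n̄`-equivariant mod `p`;
* **`prime_le_classGroupChiCard_of_not_isAddCyclic_odd`** — `K` CM, Galois/ℚ, `p ∤ [K:ℚ]`, `ζ`, `a`; `n, m` with `p ∣ m σ n σ − 1`,
  the decomposition condition at `p`, `χ` a lift of `n̄` (ODD, as forced by `θ` even), `θ` an even lift `≠ 1` of `ā m̄ = ω̄ n̄⁻¹`:
  `e_χ(ℤ_p ⊗ Cl K)` not cyclic ⟹ `p ≤ #e_θ(ℤ_p ⊗ Cl K)` (in particular `≠ 1`: EVEN-IRREGULAR, the hypothesis of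
  `KummerRadical.exists_two_independent_kummer_characters_of_classGroupChiCard_ne_one`).

* §3 (APPENDED) **`classGroupChiCard_ne_one_of_not_isAddCyclic_of_odd_character`** — the same in the REFLECTION-PAIR currency of
  `finite_and_natCard_le_prime_mul_classGroupChiCard_of_odd_characters` (p681948) / `SelmerCount.…_of_classGroupChiCard_ne_one_of_cmRamified`
  (w2 g11, p685598): `χ̄` ODD, `ψ̄ = ā χ̄⁻¹ ≠ 1`, the decomposition condition spelled `ā(σ) χ̄(σ)⁻¹ ≠ 1`, and
  `e_{ω∘χ̄}(ℤ_p ⊗ Cl K)` NOT cyclic ⊢ `p ≤ #e_{ω∘ψ̄}(ℤ_p ⊗ Cl K)`, in particular `≠ 1` (EVEN-IRREGULAR).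

References: [Washington1997] Thm. 10.9, §10.2; [Lang1990] Ch. 13 §2 Thm. 2.1; [Lang1983AbelianVarieties] Ch. VII §1 (`N(p) = ℤ_p ⊗ N`).
-/

set_option autoImplicit false
-- `…BirchSwinnertonDyer.BirchSwinnertonDyer.Theorems…` is the problem's mandated namespace (D-0017).
set_option linter.dupNamespace false

noncomputable section

namespace Summit.BirchSwinnertonDyer.BirchSwinnertonDyer.Theorems.PrintCFram.HerbrandKummer

open Literature.NumberTheory.NumberFields Literature.RepresentationTheory.FiniteGroups
open Literature.Geometry.Kaehler.FiniteAddGroup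
open NumberField NumberField.IsCMField IsDedekindDomain Module
open scoped nonZeroDivisors Pointwise TensorProduct DirectSum

/-! ## §1 Two functionals on a non-cyclic finite abelian `p`-group -/

section Algebra

/-- **A non-cyclic finite abelian group of `p`-power order maps onto `ℤ/p × ℤ/p`** by two homomorphisms: in a decomposition
`C ≃ ⨁ ℤ/nᵢ` (`nᵢ > 1`, here powers of `p`) at least two factors occur, and their reductions mod `p` do it. [folklore] -/
theorem exists_two_addMonoidHom_surjective_of_not_isAddCyclic {p : ℕ} [hp : Fact p.Prime] {C : Type*} [AddCommGroup C]
    [Finite C] {a : ℕ} (hC : Nat.card C = p ^ a) (hnc : ¬ IsAddCyclic C) :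
    ∃ l₁ l₂ : C →+ ZMod p, Function.Surjective fun c => (l₁ c, l₂ c) := by
  classical
  obtain ⟨ι, _, n, hn, ⟨f⟩⟩ := AddCommGroup.equiv_directSum_zmod_of_finite' C
  haveI : ∀ i, NeZero (n i) := fun i => ⟨by have := hn i; omega⟩
  -- each `n i` is a multiple of `p`
  have hdvd : ∀ i, p ∣ n i := by
    intro i
    have h1 : addOrderOf (DirectSum.of (fun i => ZMod (n i)) i (1 : ZMod (n i))) = n i := by
      rw [addOrderOf_injective (DirectSum.of (fun i => ZMod (n i)) i) (DirectSum.of_injective i) (1 : ZMod (n i)),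
        ZMod.addOrderOf_one]
    have h2 : n i ∣ p ^ a := by
      rw [← hC, Nat.card_congr f.toEquiv, ← h1]
      exact addOrderOf_dvd_natCard _
    obtain ⟨b, -, hb⟩ := (Nat.dvd_prime_pow hp.out).1 h2
    have hb0 : b ≠ 0 := by
      rintro rfl
      rw [pow_zero] at hb
      exact absurd hb (hn i).ne'
    rw [hb]
    exact dvd_pow_self p hb0
  -- two distinct indices (else the sum is cyclic)
  have hι : ∃ i j : ι, i ≠ j := by
    by_contra h
    push Not at h
    haveI : Subsingleton ι := ⟨h⟩
    apply hnc
    rcases isEmpty_or_nonempty ι with hι | ⟨⟨i₀⟩⟩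
    · haveI : Subsingleton (⨁ i, ZMod (n i)) := ⟨fun x y => DFinsupp.ext fun i => isEmptyElim i⟩
      haveI : Subsingleton C := f.toEquiv.subsingleton
      infer_instance
    · have hgen : ∀ x : ⨁ i, ZMod (n i), ∃ k : ℤ, k • DirectSum.of (fun i => ZMod (n i)) i₀ 1 = x := by
        intro x
        refine ⟨((x i₀).val : ℤ), ?_⟩
        rw [← map_zsmul, natCast_zsmul, nsmul_one, ZMod.natCast_zmod_val]
        refine DFinsupp.ext fun j => ?_
        obtain rfl : j = i₀ := Subsingleton.elim j i₀
        rw [DirectSum.of_eq_same]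
      refine ⟨f.symm (DirectSum.of (fun i => ZMod (n i)) i₀ 1), fun c => ?_⟩
      obtain ⟨k, hk⟩ := hgen (f c)
      exact ⟨k, by
        show k • f.symm _ = c
        rw [← map_zsmul, hk, AddEquiv.symm_apply_apply]⟩
  obtain ⟨i, j, hij⟩ := hι
  -- the two coordinate functionals, reduced mod `p`
  let lam : ∀ k : ι, (⨁ i, ZMod (n i)) →+ ZMod p := fun k =>
    (ZMod.castHom (hdvd k) (ZMod p)).toAddMonoidHom.comp (DFinsupp.evalAddMonoidHom k)
  have hlam : ∀ (k : ι) (x : ⨁ i, ZMod (n i)), lam k x = ZMod.castHom (hdvd k) (ZMod p) (x k) := fun k x => rfl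
  refine ⟨(lam i).comp f.toAddMonoidHom, (lam j).comp f.toAddMonoidHom, fun xy => ?_⟩
  obtain ⟨x', hx'⟩ := ZMod.ringHom_surjective (ZMod.castHom (hdvd i) (ZMod p)) xy.1
  obtain ⟨y', hy'⟩ := ZMod.ringHom_surjective (ZMod.castHom (hdvd j) (ZMod p)) xy.2
  refine ⟨f.symm (DirectSum.of (fun i => ZMod (n i)) i x' + DirectSum.of (fun i => ZMod (n i)) j y'), Prod.ext ?_ ?_⟩
  · show lam i (f (f.symm _)) = xy.1
    rw [AddEquiv.apply_symm_apply, hlam, DirectSum.add_apply, DirectSum.of_eq_same, DirectSum.of_eq_of_ne _ _ _ hij,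
      add_zero, hx']
  · show lam j (f (f.symm _)) = xy.2
    rw [AddEquiv.apply_symm_apply, hlam, DirectSum.add_apply, DirectSum.of_eq_same, DirectSum.of_eq_of_ne _ _ _ hij.symm,
      zero_add, hy']

end Algebra

/-! ## §2 On the class group: equivariant characters from a non-cyclic `χ`-component -/

section ClassGroupHoms

variable {K : Type} [Field K] [NumberField K]

/-- **Two jointly onto `χ̄`-equivariant characters of `Cl(K)` from a non-cyclic `χ`-component.** Let `K` be a number field,
`χ : Aut_ℚ(K) →* ℤ_pˣ` with integer shadow `n` (`‖χ σ − n σ‖ < 1`) (no hypothesis on `[K : ℚ]`: the image of `e_χ` consists of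
`χ`-eigenvectors unconditionally). If `e_χ(ℤ_p ⊗ Cl(𝓞 K))` is NOT cyclic, there are
`φ₁, φ₂ : Cl(𝓞 K) →* ℤ/p` with `φᵢ(σ • c) = φᵢ(c)^{n σ}` and `(φ₁, φ₂)` onto `ℤ/p × ℤ/p`.
[cite: Washington1997, §10.2 (proof of Thm. 10.9)] [cite: Lang1983AbelianVarieties, Ch. VII §1, Theorem 1 (proof), p. 182] -/
theorem exists_two_equivariant_classGroupHoms_of_not_isAddCyclic {p : ℕ} [hp : Fact p.Prime]
    (χ : (K ≃ₐ[ℚ] K) →* ℤ_[p]ˣ) (n : (K ≃ₐ[ℚ] K) → ℕ)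
    (hχn : ∀ σ : K ≃ₐ[ℚ] K, ‖((χ σ : ℤ_[p]ˣ) : ℤ_[p]) - (n σ : ℤ_[p])‖ < 1)
    (hnc : ¬ IsAddCyclic (classGroupChiComponent ℚ K p (fun g => ((χ g : ℤ_[p]ˣ) : ℤ_[p])))) :
    ∃ φ₁ φ₂ : ClassGroup (𝓞 K) →* Multiplicative (ZMod p),
      (∀ (σ : K ≃ₐ[ℚ] K) (c : ClassGroup (𝓞 K)), φ₁ (ClassGroup.mulEquiv (AmbiguousClass.intAut σ) c) = φ₁ c ^ n σ) ∧
      (∀ (σ : K ≃ₐ[ℚ] K) (c : ClassGroup (𝓞 K)), φ₂ (ClassGroup.mulEquiv (AmbiguousClass.intAut σ) c) = φ₂ c ^ n σ) ∧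
      Function.Surjective (φ₁.prod φ₂) := by
  classical
  set N := Additive (ClassGroup (𝓞 K)) with hN
  set ρ := pClassGroupRep ℚ K p with hρ
  set C := classGroupChiComponent ℚ K p (fun g => ((χ g : ℤ_[p]ˣ) : ℤ_[p])) with hCdef
  -- `C` is a finite group of `p`-power order
  have hV : Nat.card (ℤ_[p] ⊗[ℤ] N) = p ^ (Nat.card N).factorization p := natCard_padicIntTensor N p
  haveI : Finite (ℤ_[p] ⊗[ℤ] N) :=
    Nat.finite_of_card_ne_zero (by rw [hV]; exact pow_ne_zero _ hp.out.ne_zero)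
  obtain ⟨b, -, hb⟩ := (Nat.dvd_prime_pow hp.out).1 (hV ▸ C.toAddSubgroup.card_addSubgroup_dvd_card)
  obtain ⟨l₁, l₂, hl⟩ := exists_two_addMonoidHom_surjective_of_not_isAddCyclic (C := C) hb hnc
  -- the equivariant surjection `π : Cl ↠ e_χ(ℤ_p ⊗ Cl)`
  let eC : (ℤ_[p] ⊗[ℤ] N) →ₗ[ℤ_[p]] C := (charProjector ρ (fun g => ((χ g : ℤ_[p]ˣ) : ℤ_[p]))).rangeRestrict
  let π : N →+ C := eC.toAddMonoidHom.comp (toPadicTensor N p)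
  have hπ_surj : Function.Surjective π :=
    (LinearMap.surjective_rangeRestrict _).comp (toPadicTensor_surjective (N := N) (p := p))
  have hπσ : ∀ (σ : K ≃ₐ[ℚ] K) (x : N), π (classGroupRep ℚ K σ x) = ((χ σ : ℤ_[p]ˣ) : ℤ_[p]) • π x := by
    intro σ x
    apply Subtype.ext
    show charProjector ρ _ (toPadicTensor N p (classGroupRep ℚ K σ x)) =
      ((χ σ : ℤ_[p]ˣ) : ℤ_[p]) • charProjector ρ _ (toPadicTensor N p x)
    have hcomm := LinearMap.congr_fun (charProjector_comm ρ (ψ := fun g => ((χ g : ℤ_[p]ˣ) : ℤ_[p]))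
      (fun s t => by rw [map_mul, map_mul, map_inv, mul_inv_cancel_comm]) σ) ((1 : ℤ_[p]) ⊗ₜ[ℤ] x)
    rw [LinearMap.comp_apply, LinearMap.comp_apply] at hcomm
    rw [toPadicTensor_apply, toPadicTensor_apply, ← baseChangeRep_apply_tmul ℤ_[p] (classGroupRep ℚ K) σ (1 : ℤ_[p]) x]
    exact hcomm.trans (apply_charProjector_character ρ χ σ _)
  -- a functional of `C` pulled back to `Cl` is `n̄`-equivariant mod `p`
  have hequiv : ∀ (l : C →+ ZMod p) (σ : K ≃ₐ[ℚ] K) (x : N), l (π (classGroupRep ℚ K σ x)) = n σ • l (π x) := by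
    intro l σ x
    obtain ⟨w, hw⟩ := (PadicInt.norm_lt_one_iff_dvd _).1 (hχn σ)
    have h1 : ((χ σ : ℤ_[p]ˣ) : ℤ_[p]) • π x = n σ • π x + p • (w • π x) := by
      rw [← Nat.cast_smul_eq_nsmul ℤ_[p] (n σ), ← Nat.cast_smul_eq_nsmul ℤ_[p] p, smul_smul, ← add_smul, ← hw,
        add_sub_cancel]
    have hp0 : ∀ z : ZMod p, p • z = 0 := fun z => by rw [nsmul_eq_mul, ZMod.natCast_self, zero_mul]
    rw [hπσ, h1, map_add, map_nsmul, map_nsmul, hp0, add_zero]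
  refine ⟨AddMonoidHom.toMultiplicativeRight (l₁.comp π), AddMonoidHom.toMultiplicativeRight (l₂.comp π),
    fun σ c => ?_, fun σ c => ?_, fun xy => ?_⟩
  · show Multiplicative.ofAdd (l₁ (π (Additive.ofMul _))) = Multiplicative.ofAdd (l₁ (π (Additive.ofMul c))) ^ n σ
    rw [← classGroupRep_apply, hequiv, ofAdd_nsmul]
  · show Multiplicative.ofAdd (l₂ (π (Additive.ofMul _))) = Multiplicative.ofAdd (l₂ (π (Additive.ofMul c))) ^ n σ
    rw [← classGroupRep_apply, hequiv, ofAdd_nsmul]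
  · obtain ⟨y, hy⟩ := hl (xy.1.toAdd, xy.2.toAdd)
    obtain ⟨x, rfl⟩ := hπ_surj y
    have hy1 : l₁ (π x) = Multiplicative.toAdd xy.1 := congrArg Prod.fst hy
    have hy2 : l₂ (π x) = Multiplicative.toAdd xy.2 := congrArg Prod.snd hy
    refine ⟨Additive.toMul x, Prod.ext ?_ ?_⟩
    · show Multiplicative.ofAdd (l₁ (π (Additive.ofMul (Additive.toMul x)))) = xy.1
      rw [ofMul_toMul, hy1, ofAdd_toAdd]
    · show Multiplicative.ofAdd (l₂ (π (Additive.ofMul (Additive.toMul x)))) = xy.2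
      rw [ofMul_toMul, hy2, ofAdd_toAdd]

/-- **A NON-CYCLIC ODD COMPONENT FORCES EVEN-IRREGULARITY.** Let `K` be a CM field, Galois over `ℚ` with `p ∤ [K : ℚ]`,
`ζ ∈ K` a primitive `p`-th root of unity with `σ ζ = ζ^{a σ}`; `n, m : Gal(K/ℚ) → ℕ` with `p ∣ m σ n σ − 1`; the decomposition
condition at `p`; `χ : Gal(K/ℚ) →* ℤ_pˣ` a lift of `n̄` and `θ : Gal(K/ℚ) →* ℤ_pˣ` an EVEN lift `≠ 1` of `ā m̄ = ω̄ n̄⁻¹` (so `n̄` is odd).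
If the `χ`-component `e_χ(ℤ_p ⊗ Cl(𝓞 K))` is NOT cyclic, then `p ≤ #e_θ(ℤ_p ⊗ Cl(𝓞 K))` — Leopoldt's reflection
«`r_p(A^{χ}) ≤ 1 + r_p(A^{ω χ⁻¹})`» read as «`r_p(A^χ) ≥ 2 ⟹ A^{ωχ⁻¹} ≠ 0`». In the B1 census (`n̄ = χ̄` the odd character of the
Selmer line, `θ = θ_e`): the «non-cyclic `χ`-part» sub-branch is EVEN-IRREGULAR.
[cite: Washington1997, Thm. 10.9 and §10.2 (proof)] [cite: Lang1990, Ch. 13 §2 Thm. 2.1] -/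
theorem prime_le_classGroupChiCard_of_not_isAddCyclic_odd [IsCMField K] [IsGalois ℚ K]
    {p : ℕ} [Fact p.Prime] (hpK : ¬ p ∣ Module.finrank ℚ K) {ζ : K} (hζ : IsPrimitiveRoot ζ p)
    (n m a : (K ≃ₐ[ℚ] K) → ℕ) (hmn : ∀ σ : K ≃ₐ[ℚ] K, p ∣ m σ * n σ - 1) (hmn1 : ∀ σ : K ≃ₐ[ℚ] K, 1 ≤ m σ * n σ)
    (ha : ∀ σ : K ≃ₐ[ℚ] K, σ ζ = ζ ^ a σ)
    (hdec : ∀ v : HeightOneSpectrum (𝓞 K), ((p : ℕ) : 𝓞 K) ∈ v.asIdeal →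
      ∃ σ : K ≃ₐ[ℚ] K, σ • v.asIdeal = v.asIdeal ∧ ¬ ((a σ * m σ : ℕ) : ZMod p) = 1)
    (χ : (K ≃ₐ[ℚ] K) →* ℤ_[p]ˣ) (hχn : ∀ σ : K ≃ₐ[ℚ] K, ‖((χ σ : ℤ_[p]ˣ) : ℤ_[p]) - (n σ : ℤ_[p])‖ < 1)
    (θ : (K ≃ₐ[ℚ] K) →* ℤ_[p]ˣ) (hθ : ∀ σ : K ≃ₐ[ℚ] K, ‖((θ σ : ℤ_[p]ˣ) : ℤ_[p]) - ((a σ * m σ : ℕ) : ℤ_[p])‖ < 1)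
    (hθ1 : θ ≠ 1) (hθc : θ ((complexConj K).restrictScalars ℚ) = 1)
    (hnc : ¬ IsAddCyclic (classGroupChiComponent ℚ K p (fun g => ((χ g : ℤ_[p]ˣ) : ℤ_[p])))) :
    p ≤ classGroupChiCard ℚ K p (fun g => ((θ g : ℤ_[p]ˣ) : ℤ_[p])) := by
  obtain ⟨φ₁, φ₂, hφ₁, hφ₂, hsurj⟩ := exists_two_equivariant_classGroupHoms_of_not_isAddCyclic χ n hχn hnc
  exact prime_le_classGroupChiCard_of_two_equivariant_classGroupHoms hpK hζ n m a hmn hmn1 ha hdec θ hθ hθ1 hθc φ₁ φ₂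
    hφ₁ hφ₂ hsurj

end ClassGroupHoms

/-! ## §3 The reflection-pair currency `(χ̄ odd, ψ̄ = ā χ̄⁻¹ even)` (APPENDED) -/

section ReflectionPair

open Literature.NumberTheory.EllipticCurves.Kato2004

variable {K : Type} [Field K] [NumberField K]

/-- **NON-CYCLIC ODD PART ⟹ EVEN-IRREGULAR, reflection-pair currency.** Let `K` be a CM field, Galois over `ℚ` with `p ∤ [K : ℚ]`,
`ζ ∈ K` a primitive `p`-th root of unity with `σ ζ = ζ^{a σ}`; `χ̄ : Gal(K/ℚ) →* (ℤ/p)ˣ` ODD (`χ̄(c) = −1`) and `ψ̄` its reflection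
(`ψ̄ σ = a σ · χ̄(σ)⁻¹`, even) with `ψ̄ ≠ 1`; assume the decomposition condition «for every `v ∣ p` some `σ` fixing `v` has
`ā(σ) χ̄(σ)⁻¹ ≠ 1`» (the spelling of p681948). If the `ω∘χ̄`-component `e_{ω∘χ̄}(ℤ_p ⊗ Cl(𝓞 K))` (`ω∘χ̄ = teichmullerChar p ∘ χ̄`; order
`p^{v_p(B_{1,χ⁻¹})}` by Mazur–Wiles) is NOT cyclic, then `p ≤ #e_{ω∘ψ̄}(ℤ_p ⊗ Cl(𝓞 K))`; in particular `K` is EVEN-IRREGULAR at `ψ̄`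
(`classGroupChiCard ℚ K p (ω∘ψ̄) ≠ 1`, the hypothesis of `SelmerCount.exists_sha_ne_zero_…_of_classGroupChiCard_ne_one_of_cmRamified`).
[cite: Washington1997, Thm. 10.9 and §10.2 (proof)] [cite: Lang1990, Ch. 13 §2 Thm. 2.1] -/
theorem prime_le_classGroupChiCard_of_not_isAddCyclic_of_odd_character [IsCMField K] [IsGalois ℚ K]
    {p : ℕ} [Fact p.Prime] (hpK : ¬ p ∣ Module.finrank ℚ K) {ζ : K} (hζ : IsPrimitiveRoot ζ p)
    (a : (K ≃ₐ[ℚ] K) → ℕ) (ha : ∀ σ : K ≃ₐ[ℚ] K, σ ζ = ζ ^ a σ)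
    (χb : (K ≃ₐ[ℚ] K) →* (ZMod p)ˣ) (hoddχ : χb ((complexConj K).restrictScalars ℚ) = -1)
    (hdec : ∀ v : HeightOneSpectrum (𝓞 K), ((p : ℕ) : 𝓞 K) ∈ v.asIdeal →
      ∃ σ : K ≃ₐ[ℚ] K, σ • v.asIdeal = v.asIdeal ∧
        ¬ ((a σ : ZMod p) * (((χb σ)⁻¹ : (ZMod p)ˣ) : ZMod p)) = 1)
    (ψb : (K ≃ₐ[ℚ] K) →* (ZMod p)ˣ) (hψb1 : ψb ≠ 1)
    (hψb : ∀ σ : K ≃ₐ[ℚ] K, ((ψb σ : (ZMod p)ˣ) : ZMod p) = (a σ : ZMod p) * (((χb σ)⁻¹ : (ZMod p)ˣ) : ZMod p))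
    (hnc : ¬ IsAddCyclic (classGroupChiComponent ℚ K p (fun g => ((((teichmullerChar p).comp χb) g : ℤ_[p]ˣ) : ℤ_[p])))) :
    p ≤ classGroupChiCard ℚ K p (fun g => ((((teichmullerChar p).comp ψb) g : ℤ_[p]ˣ) : ℤ_[p])) := by
  classical
  have hp : p.Prime := Fact.out
  -- exponents: `n = val ∘ χ̄`, `m = val ∘ χ̄⁻¹`, so that `ā m̄ = ψ̄` and `m̄ n̄ = 1`
  set n : (K ≃ₐ[ℚ] K) → ℕ := fun σ => ((χb σ : (ZMod p)ˣ) : ZMod p).val with hndef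
  set m : (K ≃ₐ[ℚ] K) → ℕ := fun σ => (((χb σ)⁻¹ : (ZMod p)ˣ) : ZMod p).val with hmdef
  have hm : ∀ σ : K ≃ₐ[ℚ] K, ((a σ * m σ : ℕ) : ZMod p) = (a σ : ZMod p) * (((χb σ)⁻¹ : (ZMod p)ˣ) : ZMod p) := fun σ => by
    rw [Nat.cast_mul, hmdef, ZMod.natCast_zmod_val]
  have hmn_mod : ∀ σ : K ≃ₐ[ℚ] K, ((m σ * n σ : ℕ) : ZMod p) = 1 := fun σ => by
    rw [Nat.cast_mul, hmdef, hndef, ZMod.natCast_zmod_val, ZMod.natCast_zmod_val, Units.inv_mul]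
  have hmn1 : ∀ σ : K ≃ₐ[ℚ] K, 1 ≤ m σ * n σ := fun σ => by
    rcases Nat.eq_zero_or_pos (m σ * n σ) with h0 | hpos
    · have h := hmn_mod σ
      rw [h0, Nat.cast_zero] at h
      exact absurd h zero_ne_one
    · exact hpos
  have hmn : ∀ σ : K ≃ₐ[ℚ] K, p ∣ m σ * n σ - 1 := fun σ => by
    rw [← ZMod.natCast_eq_zero_iff, Nat.cast_sub (hmn1 σ), hmn_mod σ, Nat.cast_one, sub_self]
  -- the lifts `χ = ω∘χ̄` of `n̄` and `θ = ω∘ψ̄` of `ā m̄`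
  have hχn : ∀ σ : K ≃ₐ[ℚ] K,
      ‖((((teichmullerChar p).comp χb) σ : ℤ_[p]ˣ) : ℤ_[p]) - (n σ : ℤ_[p])‖ < 1 := fun σ =>
    norm_teichmullerChar_comp_sub_lt_one χb σ _ (ZMod.natCast_zmod_val _).symm
  have hθ : ∀ σ : K ≃ₐ[ℚ] K,
      ‖((((teichmullerChar p).comp ψb) σ : ℤ_[p]ˣ) : ℤ_[p]) - ((a σ * m σ : ℕ) : ℤ_[p])‖ < 1 := fun σ =>
    norm_teichmullerChar_comp_sub_lt_one ψb σ _ (by rw [hψb σ, hm σ])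
  have hθc : ((teichmullerChar p).comp ψb) ((complexConj K).restrictScalars ℚ) = 1 := by
    have h1 : ((ψb ((complexConj K).restrictScalars ℚ) : (ZMod p)ˣ) : ZMod p) = 1 := by
      rw [hψb, hoddχ, inv_neg_one, Units.val_neg, Units.val_one, natCast_cycloExp_complexConj hp hζ a ha]
      ring
    have h2 : ψb ((complexConj K).restrictScalars ℚ) = 1 := Units.ext (by rw [h1, Units.val_one])
    rw [MonoidHom.comp_apply, h2, map_one]
  have hθ1 : (teichmullerChar p).comp ψb ≠ 1 := by
    intro h
    apply hψb1
    ext σ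
    have h3 := DFunLike.congr_fun h σ
    rw [MonoidHom.comp_apply, MonoidHom.one_apply, ← (teichmullerChar p).map_one] at h3
    rw [teichmullerChar_injective p h3, MonoidHom.one_apply]
  have hdec' : ∀ v : HeightOneSpectrum (𝓞 K), ((p : ℕ) : 𝓞 K) ∈ v.asIdeal →
      ∃ σ : K ≃ₐ[ℚ] K, σ • v.asIdeal = v.asIdeal ∧ ¬ ((a σ * m σ : ℕ) : ZMod p) = 1 := fun v hv => by
    obtain ⟨σ, hσv, hσ⟩ := hdec v hv
    exact ⟨σ, hσv, by rw [hm σ]; exact hσ⟩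
  exact prime_le_classGroupChiCard_of_not_isAddCyclic_odd hpK hζ n m a hmn hmn1 ha hdec' ((teichmullerChar p).comp χb) hχn
    ((teichmullerChar p).comp ψb) hθ hθ1 hθc hnc

/-- **EVEN-IRREGULARITY from a non-cyclic odd part** (`≠ 1` form of the previous theorem: the hypothesis currency of w2 g11's
`SelmerCount.exists_sha_ne_zero_of_forall_exists_adaptedRoot_of_classGroupChiCard_ne_one_of_cmRamified`).
[cite: Washington1997, Thm. 10.9 and §10.2 (proof)] -/
theorem classGroupChiCard_ne_one_of_not_isAddCyclic_of_odd_character [IsCMField K] [IsGalois ℚ K]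
    {p : ℕ} [Fact p.Prime] (hpK : ¬ p ∣ Module.finrank ℚ K) {ζ : K} (hζ : IsPrimitiveRoot ζ p)
    (a : (K ≃ₐ[ℚ] K) → ℕ) (ha : ∀ σ : K ≃ₐ[ℚ] K, σ ζ = ζ ^ a σ)
    (χb : (K ≃ₐ[ℚ] K) →* (ZMod p)ˣ) (hoddχ : χb ((complexConj K).restrictScalars ℚ) = -1)
    (hdec : ∀ v : HeightOneSpectrum (𝓞 K), ((p : ℕ) : 𝓞 K) ∈ v.asIdeal →
      ∃ σ : K ≃ₐ[ℚ] K, σ • v.asIdeal = v.asIdeal ∧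
        ¬ ((a σ : ZMod p) * (((χb σ)⁻¹ : (ZMod p)ˣ) : ZMod p)) = 1)
    (ψb : (K ≃ₐ[ℚ] K) →* (ZMod p)ˣ) (hψb1 : ψb ≠ 1)
    (hψb : ∀ σ : K ≃ₐ[ℚ] K, ((ψb σ : (ZMod p)ˣ) : ZMod p) = (a σ : ZMod p) * (((χb σ)⁻¹ : (ZMod p)ˣ) : ZMod p))
    (hnc : ¬ IsAddCyclic (classGroupChiComponent ℚ K p (fun g => ((((teichmullerChar p).comp χb) g : ℤ_[p]ˣ) : ℤ_[p])))) :
    classGroupChiCard ℚ K p (fun g => ((((teichmullerChar p).comp ψb) g : ℤ_[p]ˣ) : ℤ_[p])) ≠ 1 := by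
  have hp : p.Prime := Fact.out
  have h := prime_le_classGroupChiCard_of_not_isAddCyclic_of_odd_character hpK hζ a ha χb hoddχ hdec ψb hψb1 hψb hnc
  intro h1
  rw [h1] at h
  exact absurd h (not_le.2 hp.one_lt)

end ReflectionPair

end Summit.BirchSwinnertonDyer.BirchSwinnertonDyer.Theorems.PrintCFram.HerbrandKummer

end
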